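import Summits.HodgeConjecture.HodgeConjecture.Theorems.F0P3XiEvpOfRecordSCD             -- ★ the unsigned bridges (`hSCD_of_cmCharIdentityPackageTest`), record vocabulary
import Literature.NumberTheory.Rogawski1990.CharIdentityOnTestFunctionsSignedLemmas       -- (QS-ACC) F0P3b-p01 (g7): `CMNonsplitCharIdentityAtTestSigned.πs ∕ .πs_isSupercuspidal ∕ .πs_ne ∕ …`
import HarnessLib

/-!
# The supercuspidal-partner DATUM `hSCD₀` read off the SIGNED test package `CMCharIdentityPackageTestSigned` (brick (QS-SCD) of the closer edition «QCMT SIGNED»)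

Cell `hodgecm-mathlib`, F0∕P3 «U3-mult», crux H413 (`stmt-HodgeConjecture-24833`); desk F0P3b-plan (g12) DEAL 2026-09-01T09:18:05Z (reading 09:14:36Z (c)) for the
successor desk F0P3-plan (g9)'s closer ED. 26 «QCMT SIGNED» (LEAD F0P3a-plan (g10) RULING «K» K2: the character-identity letters are re-typed SIGNED by
`ε_v(H) = ω_w(−det H)`, ★ `CharIdentityOnTestFunctionsSigned` p842701); seat F0P3b-p01 (g7).  SAME namespace as ★ `F0P3XiEvpOfRecordSCD` so that the closer's Defs
:759∕:768∕:776∕:782 and closer :1003∕:1139 migrate by ONE suffix `…Test ↦ …TestSigned`.  DEF LANE: ONE definition (`hSCD_of_cmCharIdentityPackageTestSigned`, a DATA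
bridge, the signed twin of ★ `hSCD_of_cmCharIdentityPackageTest` :157 TEXT VERBATIM up to the package name) + two theorems (the `rfl` pin and the SIGNED [13.1.4] read-back
for the record's second member); no instance, no notation, no named fact, no `sorry`.  The sign does not enter the DATUM (`πˢ`, supercuspidal, `≠ πⁿ`): it rides only on
the character identity the datum satisfies (`charIdentityAtTestSigned_hSCD`).  HONEST LABEL: HC_CM is proved only modulo the 2 remaining named inputs (hLiu418, h413)
until rung 0 closes.
-/

set_option autoImplicit false
set_option linter.dupNamespace false

noncomputable section

open NumberField IsDedekindDomain MeasureTheory Filter Topology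
open scoped Matrix MatrixGroups

namespace Summit.HodgeConjecture.HodgeConjecture.Cruxes.H413.F0P3XiPacketFamilyOfRecordSCD

open Literature.NumberTheory Literature.NumberTheory.Automorphic Literature.NumberTheory.Automorphic.UnitaryGroup
open Literature.NumberTheory.Rogawski1990 Literature.NumberTheory.GaloisRepresentations
open F0P3XiLocalFamilyOfRecord F0P3XiPacketFamilyOfRecord

section BridgePackageSigned

variable (L : Type) [Field L] [NumberField L] [IsCMField L] (H : Matrix (Fin 3) (Fin 3) L)
  (hH : (H.map (cmConjRingHom L))ᵀ = H) (hHd : IsUnit H.det) (μω : HeckeCharacter L) (hμu : μω.IsUnitary)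
  -- the local data SHARED with T1's `ComparisonKit` ∕ F0P3b's `CMCharIdentityClausesTestSigned`; instance families as in ★ `F0P3XiEvpOfRecordSCD` §BridgePackage
  [∀ v : HeightOneSpectrum (𝓞 ↥(maximalRealSubfield L)), MeasurableSpace ((cmDatum L 3 H).Local v)]
  [∀ v : HeightOneSpectrum (𝓞 ↥(maximalRealSubfield L)),
    MeasurableSpace ((cmDatum L 2 (Matrix.of fun i j : Fin 2 => if i.val + j.val + 1 = 2 then (1 : L) else 0)).Local v ×
      (cmDatum L 1 (Matrix.of fun i j : Fin 1 => if i.val + j.val + 1 = 1 then (1 : L) else 0)).Local v)]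
  [∀ (v : HeightOneSpectrum (𝓞 ↥(maximalRealSubfield L)))
      (a : ((cmDatum L 2 (Matrix.of fun i j : Fin 2 => if i.val + j.val + 1 = 2 then (1 : L) else 0)).Local v ×
        (cmDatum L 1 (Matrix.of fun i j : Fin 1 => if i.val + j.val + 1 = 1 then (1 : L) else 0)).Local v)),
    MeasurableSpace (((cmDatum L 2 (Matrix.of fun i j : Fin 2 => if i.val + j.val + 1 = 2 then (1 : L) else 0)).Local v ×
        (cmDatum L 1 (Matrix.of fun i j : Fin 1 => if i.val + j.val + 1 = 1 then (1 : L) else 0)).Local v) ⧸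
      Subgroup.centralizer ({a} : Set ((cmDatum L 2 (Matrix.of fun i j : Fin 2 => if i.val + j.val + 1 = 2 then (1 : L) else 0)).Local v ×
        (cmDatum L 1 (Matrix.of fun i j : Fin 1 => if i.val + j.val + 1 = 1 then (1 : L) else 0)).Local v)))]
  [∀ (v : HeightOneSpectrum (𝓞 ↥(maximalRealSubfield L))) (γ : (cmDatum L 3 H).Local v),
    MeasurableSpace ((cmDatum L 3 H).Local v ⧸ Subgroup.centralizer ({γ} : Set ((cmDatum L 3 H).Local v)))]
  [∀ v : HeightOneSpectrum (𝓞 ↥(maximalRealSubfield L)), MeasurableSpace (Gqs L v ⧸ Subgroup.center (Gqs L v))]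
  (Δ : ∀ v : HeightOneSpectrum (𝓞 ↥(maximalRealSubfield L)), LocalTransferFactor L H v)
  (mH : ∀ v : HeightOneSpectrum (𝓞 ↥(maximalRealSubfield L)),
    OrbitalMeasureFamily ((cmDatum L 2 (Matrix.of fun i j : Fin 2 => if i.val + j.val + 1 = 2 then (1 : L) else 0)).Local v ×
      (cmDatum L 1 (Matrix.of fun i j : Fin 1 => if i.val + j.val + 1 = 1 then (1 : L) else 0)).Local v))
  (mG : ∀ v : HeightOneSpectrum (𝓞 ↥(maximalRealSubfield L)), OrbitalMeasureFamily ((cmDatum L 3 H).Local v))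
  (νG : ∀ v : HeightOneSpectrum (𝓞 ↥(maximalRealSubfield L)), Measure ((cmDatum L 3 H).Local v))
  (νH : ∀ v : HeightOneSpectrum (𝓞 ↥(maximalRealSubfield L)),
    Measure ((cmDatum L 2 (Matrix.of fun i j : Fin 2 => if i.val + j.val + 1 = 2 then (1 : L) else 0)).Local v ×
      (cmDatum L 1 (Matrix.of fun i j : Fin 1 => if i.val + j.val + 1 = 1 then (1 : L) else 0)).Local v))
  (μZ : ∀ v : HeightOneSpectrum (𝓞 ↥(maximalRealSubfield L)), Measure (Gqs L v ⧸ Subgroup.center (Gqs L v)))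
  [∀ v : HeightOneSpectrum (𝓞 ↥(maximalRealSubfield L)), BorelSpace (Gqs L v ⧸ Subgroup.center (Gqs L v))]
  [∀ v : HeightOneSpectrum (𝓞 ↥(maximalRealSubfield L)), (μZ v).IsHaarMeasure]

/-- **`hSCD₀` FROM THE SIGNED TEST PACKAGE** ★ `CMCharIdentityPackageTestSigned … Δ mH mG` (the closer's re-typed binder `hQS` in the edition «QCMT SIGNED»): the
supercuspidal partner DATUM `πˢ := ((hQS ξ).1 v …).πs` READ OFF the SIGNED [13.1.4] ON TEST FUNCTIONS (★ `CMNonsplitCharIdentityAtTestSigned.πs` ∕ `.πs_isSupercuspidal`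
∕ `.πs_ne`); the Π-type is that of ★ `hSCD_of_cmCharIdentityPackageTest` verbatim (the sign does not enter the datum).  A `noncomputable def`.
[cite: Rogawski1990, §13.1 Prop. 13.1.3 (d), Prop. 13.1.4 p. 199; §13.3 p. 202; §14.6 p. 242] -/
def hSCD_of_cmCharIdentityPackageTestSigned (hQS : CMCharIdentityPackageTestSigned L H hH hHd νH νG μω hμu Δ mH mG) :
    ∀ (ξ : OneDimAutRepH L) (v : HeightOneSpectrum (𝓞 ↥(maximalRealSubfield L)))
      (hns : ∀ w : PlacesOver L v, IsCMField.complexConj L • w.1 = w.1)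
      (T : GL (Fin 3) (LocalRing L v)) (a : LocalRing L v) (ha : IsUnit a)
      (h : formCongr (conjLocal L (IsCMField.complexConj L) v) T (H.map (algebraMap L (LocalRing L v))) =
        a • (Matrix.of fun i j : Fin 3 => if i.val + j.val + 1 = 3 then (1 : L) else 0).map (algebraMap L (LocalRing L v)))
      (π2 πn : IrrClass (Gqs L v)),
      KeysCaseTwoLabels L v (μω.semilocalComponent L v) (torusLocalComponent L (IsCMField.complexConj L) v ξ.η)
        (torusLocalComponent L (IsCMField.complexConj L) v ξ.ψ) π2 πn → ¬ πn.IsSquareIntegrable (μZ v) →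
      {πs : IrrClass ((cmDatum L 3 H).Local v) // πs.IsSupercuspidal ∧ πs ≠ IrrClass.comap (cmDatumLocalCongr L v T ha h).symm πn} :=
  fun ξ v hns T a ha h π2 πn hk hn =>
    ⟨((hQS ξ).1 v hns T a ha h (μZ v) π2 πn hk hn).πs, ((hQS ξ).1 v hns T a ha h (μZ v) π2 πn hk hn).πs_isSupercuspidal,
      ((hQS ξ).1 v hns T a ha h (μZ v) π2 πn hk hn).πs_ne⟩

/-- **PIN**: the datum's class IS the signed Test package's `πˢ`, definitionally (twin of ★ `hSCD_of_cmCharIdentityPackageTest_fst`).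
[cite: Rogawski1990, §13.1 Prop. 13.1.4 p. 199] -/
theorem hSCD_of_cmCharIdentityPackageTestSigned_fst (hQS : CMCharIdentityPackageTestSigned L H hH hHd νH νG μω hμu Δ mH mG)
    (ξ : OneDimAutRepH L) (v : HeightOneSpectrum (𝓞 ↥(maximalRealSubfield L))) (hns : ∀ w : PlacesOver L v, IsCMField.complexConj L • w.1 = w.1)
    (T : GL (Fin 3) (LocalRing L v)) (a : LocalRing L v) (ha : IsUnit a)
    (h : formCongr (conjLocal L (IsCMField.complexConj L) v) T (H.map (algebraMap L (LocalRing L v))) =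
      a • (Matrix.of fun i j : Fin 3 => if i.val + j.val + 1 = 3 then (1 : L) else 0).map (algebraMap L (LocalRing L v)))
    (π2 πn : IrrClass (Gqs L v))
    (hk : KeysCaseTwoLabels L v (μω.semilocalComponent L v) (torusLocalComponent L (IsCMField.complexConj L) v ξ.η)
      (torusLocalComponent L (IsCMField.complexConj L) v ξ.ψ) π2 πn) (hn : ¬ πn.IsSquareIntegrable (μZ v)) :
    (hSCD_of_cmCharIdentityPackageTestSigned L H hH hHd μω hμu Δ mH mG νG νH μZ hQS ξ v hns T a ha h π2 πn hk hn).1 =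
      ((hQS ξ).1 v hns T a ha h (μZ v) π2 πn hk hn).πs :=
  rfl

open scoped Classical in
/-- **THE SIGNED [13.1.4] ON TEST FUNCTIONS FOR THE RECORD'S SECOND MEMBER**: the packet `{πⁿ∘e⁻¹, hSCD₀.1}` satisfies the character identity with member traces
`ε_v(H) · Tr π(f dν_G)`, `ε_v(H) = if ∃ z, IsUnit z ∧ a = z·σ(z) then 1 else −1` — the ★ token of `CMCharIdentityClausesTestSigned` (same `open scoped Classical` instance
path). [cite: Rogawski1990, §13.1 Prop. 13.1.4 p. 199; §4.9 p. 55; §14.6 p. 242] [cite: LanglandsShelstad1987, §1] -/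
theorem charIdentityAtTestSigned_hSCD (hQS : CMCharIdentityPackageTestSigned L H hH hHd νH νG μω hμu Δ mH mG)
    (ξ : OneDimAutRepH L) (v : HeightOneSpectrum (𝓞 ↥(maximalRealSubfield L))) (hns : ∀ w : PlacesOver L v, IsCMField.complexConj L • w.1 = w.1)
    (T : GL (Fin 3) (LocalRing L v)) (a : LocalRing L v) (ha : IsUnit a)
    (h : formCongr (conjLocal L (IsCMField.complexConj L) v) T (H.map (algebraMap L (LocalRing L v))) =
      a • (Matrix.of fun i j : Fin 3 => if i.val + j.val + 1 = 3 then (1 : L) else 0).map (algebraMap L (LocalRing L v)))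
    (π2 πn : IrrClass (Gqs L v))
    (hk : KeysCaseTwoLabels L v (μω.semilocalComponent L v) (torusLocalComponent L (IsCMField.complexConj L) v ξ.η)
      (torusLocalComponent L (IsCMField.complexConj L) v ξ.ψ) π2 πn) (hn : ¬ πn.IsSquareIntegrable (μZ v)) :
    (⟨IrrClass.comap (cmDatumLocalCongr L v T ha h).symm πn,
        some (hSCD_of_cmCharIdentityPackageTestSigned L H hH hHd μω hμu Δ mH mG νG νH μZ hQS ξ v hns T a ha h π2 πn hk hn).1⟩ : CMLocalAPacket L H v).CharIdentityAtTest
      L H v (fun c f => (if ∃ z : LocalRing L v, IsUnit z ∧ a = z * conjLocal L (IsCMField.complexConj L) v z then (1 : ℂ) else -1) * c.smoothTrace (νG v) f)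
      (ξ.xiLocalChar v) (νH v) (Δ v) (mH v) (mG v) :=
  ((hQS ξ).1 v hns T a ha h (μZ v) π2 πn hk hn).charIdentityAtTestSigned_πs

open scoped Classical in
/-- **Explicit-sum form for the record's second member**: `∫ ξ_v f^H dν_H = ε_v(H) · (Tr πⁿ∘e⁻¹(f dν_G) + Tr hSCD₀.1(f dν_G))` for every `Δ_v`-matching pair of TEST functions.
[cite: Rogawski1990, §13.1 Prop. 13.1.4 p. 199; §12.3 Prop. 12.3.3 (a) p. 178; §14.6 p. 242] -/
theorem charDist_eq_mul_add_hSCD (hQS : CMCharIdentityPackageTestSigned L H hH hHd νH νG μω hμu Δ mH mG)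
    (ξ : OneDimAutRepH L) (v : HeightOneSpectrum (𝓞 ↥(maximalRealSubfield L))) (hns : ∀ w : PlacesOver L v, IsCMField.complexConj L • w.1 = w.1)
    (T : GL (Fin 3) (LocalRing L v)) (a : LocalRing L v) (ha : IsUnit a)
    (h : formCongr (conjLocal L (IsCMField.complexConj L) v) T (H.map (algebraMap L (LocalRing L v))) =
      a • (Matrix.of fun i j : Fin 3 => if i.val + j.val + 1 = 3 then (1 : L) else 0).map (algebraMap L (LocalRing L v)))
    (π2 πn : IrrClass (Gqs L v))
    (hk : KeysCaseTwoLabels L v (μω.semilocalComponent L v) (torusLocalComponent L (IsCMField.complexConj L) v ξ.η)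
      (torusLocalComponent L (IsCMField.complexConj L) v ξ.ψ) π2 πn) (hn : ¬ πn.IsSquareIntegrable (μZ v))
    (fH : (cmDatum L 2 (Matrix.of fun i j : Fin 2 => if i.val + j.val + 1 = 2 then (1 : L) else 0)).Local v ×
        (cmDatum L 1 (Matrix.of fun i j : Fin 1 => if i.val + j.val + 1 = 1 then (1 : L) else 0)).Local v → ℂ)
    (f : (cmDatum L 3 H).Local v → ℂ) (hfH : IsLocSmooth fH) (hf : IsLocSmooth f) (hΔ : IsLocalDeltaTransfer L H v (Δ v) (mH v) (mG v) fH f) :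
    charDist (ξ.xiLocalChar v) (νH v) fH =
      (if ∃ z : LocalRing L v, IsUnit z ∧ a = z * conjLocal L (IsCMField.complexConj L) v z then (1 : ℂ) else -1) *
        ((IrrClass.comap (cmDatumLocalCongr L v T ha h).symm πn).smoothTrace (νG v) f +
          (hSCD_of_cmCharIdentityPackageTestSigned L H hH hHd μω hμu Δ mH mG νG νH μZ hQS ξ v hns T a ha h π2 πn hk hn).1.smoothTrace (νG v) f) :=
  ((hQS ξ).1 v hns T a ha h (μZ v) π2 πn hk hn).charDist_eq_mul_add fH f hfH hf hΔ

end BridgePackageSigned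

end Summit.HodgeConjecture.HodgeConjecture.Cruxes.H413.F0P3XiPacketFamilyOfRecordSCD

end
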